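import Summits.BirchSwinnertonDyer.BirchSwinnertonDyer.Theorems.GenusKolyvaginAtTwoCasselsTatePTcRealSum
import Summits.BirchSwinnertonDyer.BirchSwinnertonDyer.Theorems.SemiOrdinaryEisensteinDescentShaTwoCochainClassReadout
import Summits.BirchSwinnertonDyer.BirchSwinnertonDyer.Theorems.SemiOrdinaryEisensteinDescentShaTwoCochainShell
import Summits.BirchSwinnertonDyer.BirchSwinnertonDyer.Theorems.GenusKolyvaginAtTwoCasselsTateLemma615AnyLevel
import Literature.NumberTheory.GaloisRepresentations.IdeleLocalInvariantReadoutArch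
import Literature.NumberTheory.GaloisRepresentations.IdeleBrauerReciprocityArchimedean
import Summits.BirchSwinnertonDyer.BirchSwinnertonDyer.Theorems.GenusKolyvaginAtTwoVisiblePairAtTwoCasselsTateShaThree
import Literature.NumberTheory.EllipticCurves.BSDShaCasselsTateLevelwise
import Literature.NumberTheory.EllipticCurves.WeilPairingProofs
import Literature.NumberTheory.EllipticCurves.CasselsTateSelfPairingLevel
import Summits.BirchSwinnertonDyer.BirchSwinnertonDyer.Theorems.ThetaPartnerAtTwoSignedControlAtTwoShaThreeBaseH3Units
import Literature.NumberTheory.GaloisRepresentations.LocalDualityTheorem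
import HarnessLib

/-!
# The Ш²-cochain bridge over a number field WITH REAL PLACES, step 3: the readout with archimedean terms, `hPTc` for THE maps
# over EVERY number field at EVERY level, and the Cassels–Tate fact modulo alternation at the `2`-power levels

Route `GenusKolyvaginAtTwo`, crux `KolyvaginExactAtTwo` (stmt-BirchSwinnertonDyer-22137) → Q3-inner, Cassels–Tate block at the
EVEN level OVER `ℚ` (LINE 6 capstone `hB₁`/`hB₂`; route item 19420 `CasselsTatePairingRat`); seat `bsd-line-gk2-p2` g13 (cell
`bsd-f1-sign2`), `--supports 22137`, helper. THEOREMS ONLY (no definition, no named fact, no `sorry`, no instance).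

* §1 — two `2`-torsion elements of `ℚ/ℤ` with the same support are equal (the tree's `IdeleCohomology.eq_of_two_nsmul_eq_zero_of_iff`);
* §2 `exists_sum_brauerInvariantEquiv_add_arch_eq_classBarInv_readout` — w3 g8's `…ShaTwoCochainClassReadout` identity WITHOUT its
  archimedean vanishing hypothesis: `Σ_{v ∈ T} inv_{K_v}[π_v Z|_v] + Σ_w ℓ_w = classBarInv(Φ⁻¹[γ] ∘ ∂h)` with `ℓ_w = localInvInf` of the
  descended representative, `2`-torsion, and `ℓ_w = 0 ↔ [π_w Z|_w] = 0`;
* §3 `readout_eq_zero_real` — the readout vanishes on `Ш¹(K, E[m])` for EVERY number field and EVERY level: the archimedean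
  correction `a_w` of step 2 (`exists_bridge_sum_localInvariants_eq_zero_real`) and `ℓ_w` are `2`-torsion with the same support, so
  `a_w = ℓ_w` and `readout = Σ inv + Σ ℓ = Σ inv + Σ a = 0`;
* §4 **`hPTc_canonical`** — Milne I Thm. 4.10 (a) for `Ш²(K, E[m])` in the `PTChoice` cochain form for THE canonical invariant maps,
  EVERY number field `K` (so `ℚ`), EVERY level `m ≥ 1`, EVERY elliptic `E/K`;
* §5 **`isLevelPairing_ctLevelPairing_canonical_of_alt`** — the Cassels–Tate pairing of THE maps on `Ш(E/K)[p^k]` is a LEVEL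
  pairing as soon as it is alternating (`hct_alt`), any `K`, any `E/K`, any prime power (with `h615` =
  `CasselsTateAnyLevel.lemma615Input_canonical`, `hH3` = `VisiblePairAtTwo.shaThree_mu_eq_zero`); **`exists_casselsTate_pairing_of_alt`** — the tree's Cassels–Tate
  fact `WeierstrassCurve.exists_casselsTate_pairing (K := K)` for EVERY number field MODULO Cassels' alternation at the `2`-power
  levels; in particular route item 19420 `CasselsTatePairingRat` (`K = ℚ`) is reduced to LEAD gk2-p1's `hct_alt` at `2^k`;
  `exists_casselsTate_pairing_of_levelThetaDatum` — the same residual in LEAD's currency (a `LevelThetaDatum` at `(2^k, 2)`, Morgan–Smith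
  Thm. 5.10 / the tree's `ctGeneralFun_self_eq_zero_of_levelThetaDatum`).

BSD is not proved by any of this.

References: [MilneADT2006] I Ex. 1.6 (c), Lemma 4.13, Thm. 4.10 (a)(c), §6 Prop. 6.9, Rem. 6.10–6.11, Thm. 6.13 (a), Lemma 6.15;
[CasselsFrohlichANT1967] Ch. VII §7.3 Cor. 7.4 (b), §11.2 (bis); [Cassels1962ArithmeticIV]; [SilvermanAEC2009] Thm. X.4.14.
-/

noncomputable section

open scoped Classical

-- `Summit.<P>.<Sub>` repeats `BirchSwinnertonDyer` by the tree's layout convention (D-0017)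
set_option linter.dupNamespace false
set_option autoImplicit false

namespace Summit.BirchSwinnertonDyer.BirchSwinnertonDyer.Theorems.GenusExact.CasselsTatePTcReal

open CategoryTheory CategoryTheory.Abelian groupCohomology _root_.WeierstrassCurve Field Function NumberField IsDedekindDomain
open Literature.NumberTheory.EllipticCurves
open Literature.NumberTheory.GaloisRepresentations Literature.NumberTheory.GaloisRepresentations.HomDual
  Literature.NumberTheory.GaloisCohomology
open Literature.NumberTheory.GaloisRepresentations.IdeleClassBar
open Literature.NumberTheory.GaloisRepresentations.DGMBridge Literature.NumberTheory.GaloisRepresentations.LayerDelta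
open Literature.NumberTheory.GaloisRepresentations.FreePresentation
open Literature.NumberTheory.GaloisRepresentations.IdeleReadout Literature.NumberTheory.Automorphic
open Literature.Algebra.Homology Literature.Algebra.Homology.DiscreteRep Literature.Algebra.Homology.ExtPresentation
  ContRepresentation Literature
open Literature.NumberTheory.GaloisRepresentations.DiscreteGaloisModule (units UnitsCarrier mu MuCarrier TateDual tateDual
  tateDualPairing pairingDualHom pairingDualIntertwining sha shaTwo)
open Literature.NumberTheory.GaloisRepresentations.OpenLayer (extOneEquiv)
open Literature.AnabelianGeometry.AbsoluteAnabelian (Prop121vii.brauerInvariantEquiv Prop121vii.zmodToQmodZ)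
open Summit.BirchSwinnertonDyer.BirchSwinnertonDyer.Theorems.ShaTwoCochain
open Summit.BirchSwinnertonDyer.BirchSwinnertonDyer.Theorems.ShaTwoCochainTheta
open Summit.BirchSwinnertonDyer.BirchSwinnertonDyer.Theorems.SchneiderFreeAdditiveX3.PoitouTateReduction (exists_bidual_intertwining)
open scoped ContRepresentation NumberField

/-! ## §1 Two `2`-torsion elements of `ℚ/ℤ` with the same support are equal

This is the tree's `IdeleCohomology.eq_of_two_nsmul_eq_zero_of_iff` (`IdeleBrauerReciprocityArchimedean.lean`); nothing to add. -/

/-! ## §2 Road B's readout as the finite-place invariant sum PLUS the archimedean invariants -/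

section Readout

variable (K : Type) [Field K] [NumberField K]

/-- **S3 (class side) WITH ARCHIMEDEAN TERMS**: for `(ρ₀, h, γ, c, Z)` with `δ₁[γ] = [c]` and `j_C ∘ Z = h ∘ c`, and the
finite-place projection cocycles `cZ v` of `Z` through THE idèle projections, there are `2`-torsion numbers `ℓ_w ∈ ℚ/ℤ` at the
infinite places, `ℓ_w = 0 ↔` the archimedean projection class of `Z` at `w` vanishes, and a finite `Tf` with
`Σ_{v ∈ T} inv_{K_v}[cZ v] + Σ_w ℓ_w = classBarInv K (Φ⁻¹[γ] ∘ ∂h)` for every finite `T ⊇ Tf` — w3 g8's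
`exists_sum_brauerInvariantEquiv_eq_classBarInv_readout` without its archimedean vanishing hypothesis (`ℓ_w` is `localInvInf` of the
descended representative: `two_nsmul_localInvInf`, `twoCocycleClass_eq_zero_iff_localInvInf_of_descended`, `IdeleCohomology.inv_eq_sum`).
[cite: CasselsFrohlichANT1967, Ch. VII §7.3 Cor. 7.4 (b), §11.2 (bis)][cite: MilneADT2006, I Thm. 4.10 (a) (proof, p. 58), Ex. 1.6 (c)] -/
theorem exists_sum_brauerInvariantEquiv_add_arch_eq_classBarInv_readout
    {M : Type} [AddCommGroup M] [TopologicalSpace M] [DiscreteTopology M] [Finite M]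
    (ρ₀ : DiscreteGaloisModule K M)
    (h : (presentationComplex ρ₀).X₁ ⟶ classBarD K) (γ : contOneCocycles ρ₀.toTopRep)
    (c : contTwoCocycles (presModule₁ ρ₀).toTopRep)
    (Z : contTwoCocycles (toDGM (ideleBarD K)).toTopRep)
    (h4 : haveI := moduleFinite_presModule₁ ρ₀
      (pres_isSES ρ₀).δ₁ (oneCocycleClass _ γ) = twoCocycleClass _ c)
    (h5 : ∀ σ τ : absoluteGaloisGroup K,
      ideleToClassI K (Z.1 (σ, τ)) = lmap (presentationComplex ρ₀).X₁ (classBarD K) h (c.1 (σ, τ)))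
    (cZ : (v : HeightOneSpectrum (𝓞 K)) →
      haveI := charZero_adicCompletion v; contTwoCocycles (units (v.adicCompletion K)).toTopRep)
    (hcZ : ∀ (v : HeightOneSpectrum (𝓞 K)) (s t : absoluteGaloisGroup (v.adicCompletion K)),
      (cZ v).1 (s, t) = ((ideleProjection K (Sum.inr v)).toAddMonoidHom.comp (LCarrier.val (ideleBarD K)))
        (Z.1 (absGaloisRestrict K (v.adicCompletion K) s, absGaloisRestrict K (v.adicCompletion K) t))) :
    ∃ ℓ : InfinitePlace K → AddCircle (1 : ℚ),
      (∀ w : InfinitePlace K, 2 • ℓ w = 0) ∧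
      (∀ (w : InfinitePlace K) (cW : contTwoCocycles (units (Place.Completion (Sum.inl w : Place K))).toTopRep),
        (∀ s t : absoluteGaloisGroup (Place.Completion (Sum.inl w : Place K)),
          cW.1 (s, t) = ((ideleProjection K (Sum.inl w)).toAddMonoidHom.comp (LCarrier.val (ideleBarD K)))
            (Z.1 (absGaloisRestrict K (Place.Completion (Sum.inl w : Place K)) s,
              absGaloisRestrict K (Place.Completion (Sum.inl w : Place K)) t))) →
        ((haveI := absoluteGaloisGroup_compactSpace (Place.Completion (Sum.inl w : Place K));
          twoCocycleClass (units (Place.Completion (Sum.inl w : Place K))).toTopRep cW) = 0 ↔ ℓ w = 0)) ∧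
      ∃ Tf : Finset (HeightOneSpectrum (𝓞 K)), ∀ T : Finset (HeightOneSpectrum (𝓞 K)), Tf ⊆ T →
        ∑ v ∈ T, (haveI := charZero_adicCompletion v;
            Prop121vii.brauerInvariantEquiv (v.adicCompletion K) (twoCocycleClass (units (v.adicCompletion K)).toTopRep (cZ v))) +
          ∑ w : InfinitePlace K, ℓ w =
        classBarInv K (((OpenLayer.extOneEquiv ρ₀).symm (oneCocycleClass _ γ)).comp
          (boundary (presentationComplex_shortExact ρ₀) (classBarD K) h) (rfl : 1 + 1 = 2)) := by
  haveI := moduleFinite_presModule₁ ρ₀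
  -- (I2) presentation side
  obtain ⟨E₁, hE₁, hn₁, hfd₁, w₁, ha, hb⟩ := presentationSide_identification ρ₀ h γ c h4
  have hZ₁ := hb Z h5
  -- the α/β/γ triangle of `[Z]` and (I1) the idèle side
  obtain ⟨E₂, w, b, Z₀, hx, hwb, hZ₀, hval⟩ := exists_galLayer_layerRep_triangle_idele (twoCocycleClass _ Z)
  haveI : Normal K E₂.1 := normal_layer E₂
  haveI : FiniteDimensional K E₂.1 := finiteDimensional_layer E₂
  haveI := E₁.numberField
  haveI := E₁.isGalois
  haveI := E₂.numberField
  haveI := E₂.isGalois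
  obtain ⟨hI1, hI1'⟩ := ideleSide_identification E₂ w hx
  have hTC := classInvAll_eq_classInvAll_of_infTwo_toAbsLayer_eq E₁ E₂ w₁ _ (hZ₁.symm.trans hI1)
  -- the readout is `inv_{E₂} [b]`
  have hread : classBarInv K (((OpenLayer.extOneEquiv ρ₀).symm (oneCocycleClass _ γ)).comp
        (boundary (presentationComplex_shortExact ρ₀) (classBarD K) h) (rfl : 1 + 1 = 2)) =
      IdeleCohomology.inv E₂.1 (H2π (IdeleClassGroup.ideleRep K E₂.1) b) :=
    ha.trans (hTC.trans (hI1'.trans (congrArg (IdeleCohomology.inv E₂.1) hwb)))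
  -- the finite support of the finite invariants of `[b]`
  obtain ⟨Tf, hTf⟩ := IdeleCohomology.exists_finset_forall_localInv_eq_zero (F := K) (E := E₂.1)
    (H2π (IdeleClassGroup.ideleRep K E₂.1) b)
  refine ⟨fun w' => IdeleCohomology.localInvInf E₂.1 w' (H2π (IdeleClassGroup.ideleRep K E₂.1) b),
    fun w' => IdeleCohomology.two_nsmul_localInvInf w' _, fun w' cW hcW => ?_, Tf, fun T hT => ?_⟩
  · -- the archimedean dictionary on the descended representative
    exact twoCocycleClass_eq_zero_iff_localInvInf_of_descended E₂ hZ₀ hval Z rfl w' cW hcW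
  · have hsum : ∑ v ∈ T, (haveI := charZero_adicCompletion v;
          Prop121vii.brauerInvariantEquiv (v.adicCompletion K) (twoCocycleClass (units (v.adicCompletion K)).toTopRep (cZ v))) =
        ∑ v ∈ T, IdeleCohomology.localInv E₂.1 v (H2π (IdeleClassGroup.ideleRep K E₂.1) b) :=
      Finset.sum_congr rfl fun v _ => brauerInvariant_eq_localInv_of_descended E₂ hZ₀ hval Z rfl v (cZ v) (hcZ v)
    have hinvT := IdeleCohomology.inv_eq_sum (H2π (IdeleClassGroup.ideleRep K E₂.1) b) T
      (fun v hv => hTf v fun hv' => hv (hT hv'))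
    exact ((congrArg (fun s => s + ∑ w' : InfinitePlace K, IdeleCohomology.localInvInf E₂.1 w'
      (H2π (IdeleClassGroup.ideleRep K E₂.1) b)) hsum).trans hinvT.symm).trans hread.symm

end Readout

/-! ## §3 The readout vanishes on `Ш¹(K, E[m])`: every number field, every level, every curve -/

section Vanishing

variable {K : Type} [Field K] [NumberField K] {W : WeierstrassCurve K} {m : ℕ} [NeZero m]
variable {e : geomTorsion W ((m * m : ℕ) : ℤ) → geomTorsion W ((m * m : ℕ) : ℤ) → AlgebraicClosure K}
  {hμ : ∀ S T, e S T ^ (m * m) = 1}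
  {hadd₁ : ∀ S₁ S₂ T, e (S₁ + S₂) T = e S₁ T * e S₂ T}
  {hadd₂ : ∀ S T₁ T₂, e S (T₁ + T₂) = e S T₁ * e S T₂}
  {hgal : ∀ (σ : absoluteGaloisGroup K) (S T : geomTorsion W ((m * m : ℕ) : ℤ)), σ • e S T = e (σ • S) (σ • T)}
variable [Finite (geomTorsion W (m : ℤ))]

/-- **Road B's readout `classBarInv(Φ⁻¹[γ] ∘ ∂h)` vanishes for every `y = [γ] ∈ Ш¹(K, E[m])`, over EVERY number field and at
EVERY level `m`** (every elliptic `E/K`), given `hPTc`'s hypothesis for `f` and `Ψ h = θ′_* [f]`. Step 2 gives `Z, c, h̃` with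
(3)(4)(5) and the archimedean correction `a` with `Σ_{v∈T} inv[cZ v] + Σ_w a_w = 0`; §2 gives `ℓ` with `Σ_{v∈T} inv[cZ v] + Σ_w ℓ_w
= readout`; `a_w` and `ℓ_w` are `2`-torsion and vanish exactly when the archimedean projection class of `Z` at `w` does, so
`a_w = ℓ_w` (§1) and the readout is `0`. [cite: MilneADT2006, Ch. I Thm. 4.10 (a) (proof, pp. 57–58), Lemma 4.13, Ex. 1.6 (c)]
[cite: CasselsFrohlichANT1967, Ch. VII §11.2 (bis)] -/
theorem readout_eq_zero_real [NeZero (m * m)]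
    {f : contTwoCocycles (W.torsionGaloisModule (m : ℤ)).toTopRep}
    (hf : ∀ g : contOneCocycles (W.torsionGaloisModule (m : ℤ)).toTopRep,
      (∀ v : Place K, locClass (W.torsionGaloisModule (m : ℤ)) (Place.Completion v)
          (resOne (W.torsionGaloisModule (m : ℤ)) (Place.Completion v) g) = 0) →
      ∃ (C : PTChoice W m e hμ hadd₁ hadd₂ hgal f g) (S : Finset (Place K)),
        (∀ v ∉ S, C.localTerm (LocalInvariants.canonical K (m * m)) v = 0) ∧
          ∑ v ∈ S, C.localTerm (LocalInvariants.canonical K (m * m)) v = 0)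
    (h : (presentationComplex (W.torsionGaloisModule (m : ℤ))).X₁ ⟶ classBarD K)
    (hh : shaTwoConnecting (W.torsionGaloisModule (m : ℤ)) (m * m)
        (FirstCaseData.mul_nsmul_geomTorsion_eq_zero (W := W) (m := m)) h =
      galoisCohomology.map (pairingDualIntertwining
        (ρ₁ := W.torsionGaloisModule (m : ℤ)) (ρ₂ := W.torsionGaloisModule (m : ℤ))
        (B := (descendHom W m m e hμ hadd₁ hadd₂).flip) (ShaTwoCochainTheta.descendHom_flip_smul W m e hμ hadd₁ hadd₂ hgal)) 2
        (twoCocycleClass _ f))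
    (y : galoisCohomology (W.torsionGaloisModule (m : ℤ)) 1) (hy : y ∈ sha (W.torsionGaloisModule (m : ℤ))) :
    classBarInv K (((extOneEquiv (W.torsionGaloisModule (m : ℤ))).symm y).comp
      (boundary (presentationComplex_shortExact (W.torsionGaloisModule (m : ℤ))) (classBarD K) h) (rfl : 1 + 1 = 2)) = 0 := by
  haveI := absoluteGaloisGroup_compactSpace K
  haveI := moduleFinite_presModule₁ (W.torsionGaloisModule (m : ℤ))
  -- a cocycle `γ ∈ y`, locally trivial
  obtain ⟨γ, rfl⟩ := oneCocycleClass_surjective _ y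
  have hγ := (oneCocycleClass_mem_sha_iff_locClass (W.torsionGaloisModule (m : ℤ)) γ).1 hy
  -- step 2: the bridge sum package with its archimedean correction, for THE idèle projections
  obtain ⟨c, ht, Z, S', -, h4, h5, -, ⟨a, ha2, haj, hb⟩, -⟩ :=
    exists_bridge_sum_localInvariants_eq_zero_real (hgal := hgal) hf h hh hγ fun v => IdeleReadout.ideleProjection K v
  -- the local projection cocycles at the finite places
  choose cZ hcZ using fun v : HeightOneSpectrum (𝓞 K) =>
    exists_localProjectionCocycle Z (Sum.inr v) (IdeleReadout.ideleProjection K (Sum.inr v))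
  -- §2: the readout with archimedean terms
  obtain ⟨ℓ, hℓ2, hℓj, Tf, hTf⟩ := exists_sum_brauerInvariantEquiv_add_arch_eq_classBarInv_readout K
    (W.torsionGaloisModule (m : ℤ)) h γ c Z h4 h5 cZ hcZ
  -- the two archimedean corrections agree
  have haℓ : ∀ w : InfinitePlace K, a w = ℓ w := fun w => by
    obtain ⟨cW, -, hcW⟩ := exists_localIdeleCocycle_inf w (IdeleReadout.ideleProjection K (Sum.inl w)) Z
    exact IdeleCohomology.eq_of_two_nsmul_eq_zero_of_iff (ha2 w) (hℓ2 w) ((haj w cW hcW).symm.trans (hℓj w cW hcW))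
  -- readout `= Σ inv + Σ ℓ = Σ inv + Σ a = 0` over `T = Tf ∪ S'_fin`
  have hT := hTf (Tf ∪ S'.toRight) Finset.subset_union_left
  rw [← hT, Finset.sum_congr rfl fun w _ => (haℓ w).symm]
  exact hb (Tf ∪ S'.toRight) (fun v hv => Finset.mem_union_right _ (Finset.mem_toRight.2 hv)) cZ hcZ

end Vanishing

/-! ## §4 `hPTc` for THE maps over every number field at every level -/

section PTc

variable {K : Type} [Field K] [NumberField K] (W : WeierstrassCurve K) [W.IsElliptic] (m : ℕ) [NeZero m]
variable (e : geomTorsion W ((m * m : ℕ) : ℤ) → geomTorsion W ((m * m : ℕ) : ℤ) → AlgebraicClosure K)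
  (hμ : ∀ S T, e S T ^ (m * m) = 1)
  (hadd₁ : ∀ S₁ S₂ T, e (S₁ + S₂) T = e S₁ T * e S₂ T)
  (hadd₂ : ∀ S T₁ T₂, e S (T₁ + T₂) = e S T₁ * e S T₂)
  (hgal : ∀ (σ : absoluteGaloisGroup K) (S T : geomTorsion W ((m * m : ℕ) : ℤ)), σ • e S T = e (σ • S) (σ • T))
  (halt : ∀ T, e T T = 1) (hnd : ∀ T, (∀ S, e S T = 1) → T = 0)

include halt hnd in
/-- **Milne I Thm. 4.10 (a) for `Ш²(K, E[m])` in the `PTChoice` cochain form (`hPTc`) for THE canonical invariant maps — EVERY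
number field `K` (e.g. `ℚ`), EVERY level `m ≥ 1`, EVERY elliptic curve `E/K`** and every Weil-type alternating non-degenerate `e` on
`E[m²]`: if for every locally trivial `1`-cocycle `g` of `E[m]` there is an admissible choice for `(f, g)` whose canonical local terms
are finitely supported and sum to zero, then `[f] = 0` in `H²(K, E[m])`. The Shell's flipped exhaustion and readout-vanishing composed
with §3. This is the input `hPTc` of the tree's `isLevelPairing_ctLevelPairing_of_inputs`, now a theorem in full generality.
[cite: MilneADT2006, Ch. I Thm. 4.10 (a) (proof, pp. 57–58), Lemma 4.13, §6 Thm. 6.13 (a)][cite: CasselsFrohlichANT1967, Ch. VII §11.2 (bis)] -/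
theorem hPTc_canonical (f : contTwoCocycles (W.torsionGaloisModule (m : ℤ)).toTopRep)
    (hf : ∀ g : contOneCocycles (W.torsionGaloisModule (m : ℤ)).toTopRep,
      (∀ v : Place K, locClass (W.torsionGaloisModule (m : ℤ)) (Place.Completion v)
          (resOne (W.torsionGaloisModule (m : ℤ)) (Place.Completion v) g) = 0) →
      ∃ (C : PTChoice W m e hμ hadd₁ hadd₂ hgal f g) (S : Finset (Place K)),
        (∀ v ∉ S, C.localTerm (LocalInvariants.canonical K (m * m)) v = 0) ∧
          ∑ v ∈ S, C.localTerm (LocalInvariants.canonical K (m * m)) v = 0) :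
    twoCocycleClass _ f = 0 := by
  haveI : NeZero (m * m) := ⟨mul_ne_zero (NeZero.ne _) (NeZero.ne _)⟩
  haveI : Finite (geomTorsion W (m : ℤ)) := finite_geomTorsion_of_neZero W m
  haveI : Finite (TateDual K (geomTorsion W (m : ℤ)) (m * m)) := DiscreteGaloisModule.TateDual.finite K _ _
  obtain ⟨C, -, -⟩ := hf 0 fun v => locClass_resOne_zero _ v
  obtain ⟨ι, κ, hι, hκι, hικ⟩ := exists_bidual_intertwining (n := m * m) (W.torsionGaloisModule (m : ℤ))
    (FirstCaseData.mul_nsmul_geomTorsion_eq_zero (W := W) (m := m))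
  exact C.twoCocycleClass_eq_zero_of_shaTwoConnecting_eq_zero_flip
    (FirstCaseData.mul_nsmul_geomTorsion_eq_zero (W := W) (m := m)) halt hnd
    fun h hh => shaTwoConnecting_eq_zero_of_forall_sha_classBarInv_extOneEquiv_symm_eq_zero _ _ ι κ hι hκι hικ h
      fun y hy => readout_eq_zero_real (hgal := hgal) hf h hh y hy

end PTc

/-! ## §5 The Cassels–Tate pairing of THE maps is a level pairing as soon as it is alternating — every number field -/

section LevelPairing

variable {K : Type} [Field K] [NumberField K] (W : WeierstrassCurve K) [W.IsElliptic] (p k : ℕ) [Fact p.Prime]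
variable (e : geomTorsion W ((p ^ k * p ^ k : ℕ) : ℤ) → geomTorsion W ((p ^ k * p ^ k : ℕ) : ℤ) → AlgebraicClosure K)
  (hμ : ∀ S T, e S T ^ (p ^ k * p ^ k) = 1)
  (hadd₁ : ∀ S₁ S₂ T, e (S₁ + S₂) T = e S₁ T * e S₂ T)
  (hadd₂ : ∀ S T₁ T₂, e S (T₁ + T₂) = e S T₁ * e S T₂)
  (hgal : ∀ (σ : absoluteGaloisGroup K) (S T : geomTorsion W ((p ^ k * p ^ k : ℕ) : ℤ)), σ • e S T = e (σ • S) (σ • T))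
  (halt : ∀ T, e T T = 1) (hnd : ∀ T, (∀ S, e S T = 1) → T = 0)

include hnd in
/-- **At EVERY prime-power level `m = p^k` (`k ≥ 1`, any prime — so `p = 2`), over EVERY number field `K` (so `ℚ`) and for EVERY
elliptic curve `E/K`, the Cassels–Tate pairing `ctLevelPairing` of THE canonical invariant maps on `Ш(E/K)[m]` is a LEVEL pairing
(alternating, kernel `Ш[m] ∩ mШ`) AS SOON AS its general-case value is alternating on `Ш[m]` (`hct_alt`)**: the tree's
`isLevelPairing_ctLevelPairing_of_inputs` with `hPT'` = `sumInvLocalizationEqZero_canonical_of_numberField`, `hH3` = `Ш³ = 0`, `hPTc` =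
`hPTc_canonical` (§4), `h615` = `CasselsTateAnyLevel.lemma615Input_canonical`. Over `ℚ` at `2^L` this is `hB₁`/`hB₂` of the LINE 6
capstone modulo LEAD gk2-p1's alternation. [cite: MilneADT2006, Ch. I §6 Prop. 6.9, Thm. 6.13 (a), Lemma 6.15, Thm. 4.10][cite: Cassels1962ArithmeticIV] -/
theorem isLevelPairing_ctLevelPairing_canonical_of_alt [NeZero (p ^ k)] [NeZero (p ^ k * p ^ k)] (hk : 0 < k)
    (hct_alt : ∀ a ∈ W.sha, ((p ^ k : ℕ) : ℤ) • a = 0 →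
      ctGeneralFun W (p ^ k) e hμ hadd₁ hadd₂ hgal (LocalInvariants.canonical K (p ^ k * p ^ k)) a a = 0) :
    Literature.GroupTheory.FiniteAbelian.IsLevelPairing (p ^ k)
      (ctLevelPairing W (p ^ k) e hμ hadd₁ hadd₂ hgal (LocalInvariants.canonical K (p ^ k * p ^ k)) halt
        (sumInvLocalizationEqZero_canonical_of_numberField K (p ^ k * p ^ k)) (VisiblePairAtTwo.shaThree_mu_eq_zero K (p ^ k * p ^ k))
        (localTerm_finite_support W (p ^ k) e hμ hadd₁ hadd₂ hgal halt (LocalInvariants.canonical K (p ^ k * p ^ k)))) := by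
  haveI : Finite (geomTorsion W ((p ^ k : ℕ) : ℤ)) := finite_geomTorsion_of_neZero W (p ^ k)
  exact isLevelPairing_ctLevelPairing_of_inputs W (p ^ k) e hμ hadd₁ hadd₂ hgal
    (LocalInvariants.canonical K (p ^ k * p ^ k)) halt (sumInvLocalizationEqZero_canonical_of_numberField K (p ^ k * p ^ k))
    (VisiblePairAtTwo.shaThree_mu_eq_zero K (p ^ k * p ^ k))
    (fun f hf => hPTc_canonical W (p ^ k) e hμ hadd₁ hadd₂ hgal halt hnd f hf) ∅
    (fun S _ x hx => CasselsTateAnyLevel.lemma615Input_canonical W p k e hμ hadd₁ hadd₂ hgal halt hnd hk S x hx) hct_alt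

include halt hnd in
/-- **Existence form**: a level pairing on `Ш(E/K)[p^k]` exists as soon as the general-case Cassels–Tate value of THE maps is
alternating there — every number field, every curve, every prime power (the hypothesis shape of the tree's
`WeierstrassCurve.exists_casselsTate_pairing_of_levelwise`). [cite: MilneADT2006, Ch. I §6, Thm. 6.13 (a)][cite: SilvermanAEC2009, Thm. X.4.14] -/
theorem exists_isLevelPairing_of_alt [NeZero (p ^ k)] [NeZero (p ^ k * p ^ k)] (hk : 0 < k)
    (hct_alt : ∀ a ∈ W.sha, ((p ^ k : ℕ) : ℤ) • a = 0 →
      ctGeneralFun W (p ^ k) e hμ hadd₁ hadd₂ hgal (LocalInvariants.canonical K (p ^ k * p ^ k)) a a = 0) :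
    ∃ B : AddSubgroup.torsionBy W.sha (p ^ k) →+ AddSubgroup.torsionBy W.sha (p ^ k) →+ AddCircle (1 : ℚ),
      Literature.GroupTheory.FiniteAbelian.IsLevelPairing (p ^ k) B :=
  ⟨_, isLevelPairing_ctLevelPairing_canonical_of_alt W p k e hμ hadd₁ hadd₂ hgal halt hnd hk hct_alt⟩

end LevelPairing

/-! ## §6 The Cassels–Tate fact over every number field, modulo alternation at the `2`-power levels -/

section Fact

variable {K : Type} [Field K] [NumberField K]

/-- **`WeierstrassCurve.exists_casselsTate_pairing (K := K)` — the Cassels–Tate pairing on `Ш(E/K)` with divisible kernel for every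
elliptic curve over EVERY number field `K` (Milne I Thm. 6.13 / Silverman X.4.14) — MODULO ONE displayed input: Cassels' alternation
`⟨a, a⟩ = 0` of the general-case pairing of THE maps at the `2`-POWER levels** (`halt2`; LEAD gk2-p1's lane). Levelwise assembly
`exists_casselsTate_pairing_of_levelwise`: the Weil pairing on `E[p^{2k}]` is the tree's `exists_weilPairing_holds`; odd `p` — alternation
is `ctGeneralFun_self_eq_zero_of_odd`; `p = 2` — `halt2`. At `K = ℚ` this is route item 19420 `CasselsTatePairingRat` modulo `halt2`.
[cite: MilneADT2006, Ch. I §6 Prop. 6.9, Rem. 6.10–6.11, Thm. 6.13 (a)(b)][cite: SilvermanAEC2009, Thm. X.4.14][cite: Cassels1962ArithmeticIV] -/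
theorem exists_casselsTate_pairing_of_alt
    (halt2 : ∀ (W : WeierstrassCurve K) [W.IsElliptic] (k : ℕ), 0 < k →
      ∀ [NeZero (2 ^ k)] [NeZero (2 ^ k * 2 ^ k)]
        (e : geomTorsion W ((2 ^ k * 2 ^ k : ℕ) : ℤ) → geomTorsion W ((2 ^ k * 2 ^ k : ℕ) : ℤ) → AlgebraicClosure K)
        (hμ : ∀ S T, e S T ^ (2 ^ k * 2 ^ k) = 1)
        (hadd₁ : ∀ S₁ S₂ T, e (S₁ + S₂) T = e S₁ T * e S₂ T)
        (hadd₂ : ∀ S T₁ T₂, e S (T₁ + T₂) = e S T₁ * e S T₂)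
        (hgal : ∀ (σ : absoluteGaloisGroup K) (S T : geomTorsion W ((2 ^ k * 2 ^ k : ℕ) : ℤ)),
          σ • e S T = e (σ • S) (σ • T)),
        (∀ T, e T T = 1) → (∀ T, (∀ S, e S T = 1) → T = 0) →
        ∀ a ∈ W.sha, ((2 ^ k : ℕ) : ℤ) • a = 0 →
          ctGeneralFun W (2 ^ k) e hμ hadd₁ hadd₂ hgal (LocalInvariants.canonical K (2 ^ k * 2 ^ k)) a a = 0) :
    WeierstrassCurve.exists_casselsTate_pairing (K := K) := by
  refine WeierstrassCurve.exists_casselsTate_pairing_of_levelwise (K := K) fun W _ p k hp hk => ?_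
  haveI : Fact p.Prime := ⟨hp⟩
  haveI : NeZero (p ^ k) := ⟨pow_ne_zero _ hp.ne_zero⟩
  haveI : NeZero (p ^ k * p ^ k) := ⟨mul_ne_zero (NeZero.ne _) (NeZero.ne _)⟩
  have hpk : 2 ≤ p ^ k := le_trans hp.two_le (Nat.le_self_pow hk.ne' p)
  have h2 : 2 ≤ p ^ k * p ^ k := le_trans hpk (Nat.le_mul_of_pos_right _ (NeZero.pos _))
  have hne : ((p ^ k * p ^ k : ℕ) : K) ≠ 0 := Nat.cast_ne_zero.2 (NeZero.ne _)
  obtain ⟨e, hμ, hadd₁, hadd₂, halt, hnd, hgal⟩ := exists_weilPairing_holds W (p ^ k * p ^ k) h2 hne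
  by_cases hp2 : p = 2
  · subst hp2
    exact exists_isLevelPairing_of_alt W 2 k e hμ hadd₁ hadd₂ hgal halt hnd hk (halt2 W k hk e hμ hadd₁ hadd₂ hgal halt hnd)
  · have hodd : Odd (p ^ k) := (hp.odd_of_ne_two hp2).pow
    exact exists_isLevelPairing_of_alt W p k e hμ hadd₁ hadd₂ hgal halt hnd hk fun _ ha hma =>
      ctGeneralFun_self_eq_zero_of_odd (LocalInvariants.canonical K (p ^ k * p ^ k)) halt
        (sumInvLocalizationEqZero_canonical_of_numberField K (p ^ k * p ^ k)) (VisiblePairAtTwo.shaThree_mu_eq_zero K (p ^ k * p ^ k))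
        (localTerm_finite_support W (p ^ k) e hμ hadd₁ hadd₂ hgal halt _) hodd ha hma

/-- **The Cassels–Tate fact over EVERY number field from LEVEL THETA DATA at the `2`-power levels** — the residual in LEAD
gk2-p1's currency (`…CasselsTateSelfPairingLevel`, Morgan–Smith §5 Thm. 5.10: `ctGeneralFun_self_eq_zero_of_levelThetaDatum` gives
`⟨a, a⟩ = 0` at any level from a `LevelThetaDatum W m e … l`): if every elliptic `E/K` carries a level theta datum at `(m, l) = (2^k, 2)`
for every Weil-type pairing on `E[2^{2k}]`, then `WeierstrassCurve.exists_casselsTate_pairing (K := K)` holds (at `K = ℚ`: route item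
19420 `CasselsTatePairingRat`). [cite: MorganSmith2021CTP, §5 Thm. 5.10][cite: MilneADT2006, Ch. I §6, Thm. 6.13 (a)(b)]
[cite: SilvermanAEC2009, Thm. X.4.14] -/
theorem exists_casselsTate_pairing_of_levelThetaDatum
    (hT : ∀ (W : WeierstrassCurve K) [W.IsElliptic] (k : ℕ), 0 < k →
      ∀ [NeZero (2 ^ k)]
        (e : geomTorsion W ((2 ^ k * 2 ^ k : ℕ) : ℤ) → geomTorsion W ((2 ^ k * 2 ^ k : ℕ) : ℤ) → AlgebraicClosure K)
        (hμ : ∀ S T, e S T ^ (2 ^ k * 2 ^ k) = 1)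
        (hadd₁ : ∀ S₁ S₂ T, e (S₁ + S₂) T = e S₁ T * e S₂ T)
        (hadd₂ : ∀ S T₁ T₂, e S (T₁ + T₂) = e S T₁ * e S T₂)
        (hgal : ∀ (σ : absoluteGaloisGroup K) (S T : geomTorsion W ((2 ^ k * 2 ^ k : ℕ) : ℤ)),
          σ • e S T = e (σ • S) (σ • T)),
        (∀ T, e T T = 1) → (∀ T, (∀ S, e S T = 1) → T = 0) →
        Nonempty (LevelThetaDatum W (2 ^ k) e hμ hadd₁ hadd₂ 2)) :
    WeierstrassCurve.exists_casselsTate_pairing (K := K) :=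
  exists_casselsTate_pairing_of_alt (K := K) fun W _ k hk _ _ e hμ hadd₁ hadd₂ hgal halt hnd _ ha hma =>
    (hT W k hk e hμ hadd₁ hadd₂ hgal halt hnd).elim fun T =>
      ctGeneralFun_self_eq_zero_of_levelThetaDatum (LocalInvariants.canonical K (2 ^ k * 2 ^ k)) halt
        (sumInvLocalizationEqZero_canonical_of_numberField K (2 ^ k * 2 ^ k)) (VisiblePairAtTwo.shaThree_mu_eq_zero K (2 ^ k * 2 ^ k))
        (localTerm_finite_support W (2 ^ k) e hμ hadd₁ hadd₂ hgal halt _) T ha hma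

end Fact

end Summit.BirchSwinnertonDyer.BirchSwinnertonDyer.Theorems.GenusExact.CasselsTatePTcReal

end
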